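import Literature.AlgebraicGeometry.Resolution.StalkBaseChangeChart
import Literature.AlgebraicGeometry.Resolution.FlatLocalRegularAscent
import Literature.RingTheory.Smooth.ArtinianFormallySmoothField
import HarnessLib

/-!
# Base change of a scheme locally of finite type along a formally smooth field extension:
# the local homomorphisms `𝒪_{Y,g η'} → 𝒪_{Y',η'}` at the points where the dimension does not go up

Topic: `Literature/AlgebraicGeometry/Resolution`.  For `f : Y → Spec k` locally of finite type, a field
extension `K/k` that is FORMALLY SMOOTH (= separable, Matsumura Thm. 26.9 / EGA 0_IV 19.6.1; no
finiteness hypothesis on `K/k` — `k^sep`, `k(t₁, t₂, …)` are allowed), a cartesian square `g : Y' → Y`,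
`f' : Y' → Spec K` over `Spec K → Spec k`, and a point `η' ∈ Y'` with `𝒪_{Y,g η'}` regular and
`dim 𝒪_{Y',η'} = dim 𝒪_{Y,g η'}`, the local homomorphism `φ = g.stalkMap η'` is flat with
`𝔪 𝒪_{Y',η'} = 𝔪'`, `𝒪_{Y',η'}` is regular, and `κ(g η') → κ(η')` is formally smooth
(`formallySmoothBaseChange_localData`).  This is Matsumura Thm. 23.7 (ii) (flat, regular base, regular
fibre ⇒ regular) at a point where the fibre ring `𝒪_{Y',η'}/𝔪 𝒪_{Y',η'}` has dimension `0`; that fibre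
ring is a Noetherian local ring formally smooth over the field `κ(g η')`, hence A FIELD by Matsumura
§28 Lemma 1 in dimension `0` (`Literature.RingTheory.Smooth.isField_of_ringKrullDim_eq_zero_of_formallySmooth`,
file `Literature/RingTheory/Smooth/ArtinianFormallySmoothField.lean`).

These statements are res-type-047's (δ2) lemmas of
`Summits/ResolutionOfSingularities/ResolutionOfSingularities/Theorems/WeightedInvariantAQSBaseChangeSquare.lean`
(`AQSBaseChange.separableBaseChange_localData`, p526461; proofs followed verbatim where unchanged, with
credit) with the hypothesis `[Algebra.EssFiniteType k K]` REMOVED — there the fibre ring was regular by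
«smooth of essentially finite type over a field ⇒ regular»; here by §28 Lemma 1.  Consumer: the literal
discharge `AbramovichQuekSchober2025_separableBaseChange_holds` of the named fact
`Literature.AlgebraicGeometry.Resolution.AbramovichQuekSchober2025_separableBaseChange`
(`HypersurfaceHeightTwoWeightedCentre.lean`), whose `k'/k` is an arbitrary formally smooth extension.

* `formallySmooth_stalk_of_chart` (private helper) — chart lemma: if `c : Spec T → Y'` hits `η'` with an isomorphism on
  stalks and `c ≫ g = Spec(𝒪_{Y,g η'} → T) ≫ (Spec 𝒪_{Y,g η'} → Y)` for a formally smooth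
  `𝒪_{Y,g η'}`-algebra `T`, then `𝒪_{Y',η'}` is formally smooth over `𝒪_{Y,g η'}` (via `g.stalkMap η'`);
* `formallySmooth_stalk_of_isPullback` (private helper) — applied to the chart `Spec (𝒪_{Y,g η'} ⊗ₖ K) → Y ×ₖ Spec K ≅ Y'`
  (`stalkTensorChart`);
* `map_maximalIdeal_eq_of_formallySmooth_of_flat_of_ringKrullDim_eq` — local algebra: for a flat, formally
  smooth local homomorphism `O → B` of Noetherian local rings with `dim O = dim B`, `𝔪_O B = 𝔪_B` (flat
  going-down puts the fibre ring in dimension `0`; §28 Lemma 1 makes it a field);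
* `formallySmoothBaseChange_localData` — (i) `𝔪.map φ = 𝔪'`, (ii) `𝒪_{Y',η'}` regular
  (`IsRegularLocalRing.of_flat_of_map_maximalIdeal_eq`, Matsumura 23.7 (ii)), (iii) `φ` flat,
  (iv) `κ(g η') → κ(η')` formally smooth (private helper
  `formallySmooth_residueField_of_map_maximalIdeal_eq_maximalIdeal`), (v) `LocallyOfFiniteType f'`.

Everything is proved; no definitions, no named facts.  AI-written; weaker than expert review.

## References

* H. Matsumura, *Commutative Ring Theory*, CUP 1986: Thm. 23.7 (ii) (p. 182), §28 Lemma 1 (p. 216),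
  Thm. 26.9 (p. 206). [Matsumura1987]
* A. Grothendieck, EGA IV₂, Prop. 6.5.1 / 6.1.2 (flat local homomorphisms, dimension of the fibre).
  [Grothendieck1965]
-/

noncomputable section

open CategoryTheory CategoryTheory.Limits _root_.AlgebraicGeometry TopologicalSpace IsLocalRing Opposite
open TensorProduct

namespace Literature.AlgebraicGeometry.Resolution

universe u

/-! ## A chart `Spec T → Y'` through `η'` computes `𝒪_{Y',η'}` as an `𝒪_{Y,g η'}`-algebra -/

section Chart

variable {Y Y' : Scheme.{u}} (g : Y' ⟶ Y) (η' : Y') (T : Type u) [CommRing T]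
  [Algebra (Y.presheaf.stalk (g η')) T]
  (c : Spec (.of T) ⟶ Y') (t : ↑(Spec (.of T))) (ht : c t = η') [IsIso (c.stalkMap t)]
  (hc : c ≫ g = Spec.map (CommRingCat.ofHom (algebraMap (Y.presheaf.stalk (g η')) T)) ≫
    Y.fromSpecStalk (g η'))
include ht hc

/-- **Chart lemma (formally smooth part of res-type-047's `formallySmooth_and_essFiniteType_stalk_of_chart`).**
If `c : Spec T → Y'` hits `η'` at `t` with `c.stalkMap t` an isomorphism and
`c ≫ g = Spec (𝒪_{Y,g η'} → T) ≫ (Spec 𝒪_{Y,g η'} → Y)` for a formally smooth `𝒪_{Y,g η'}`-algebra `T`,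
then `𝒪_{Y',η'}` — an `𝒪_{Y,g η'}`-algebra through `g.stalkMap η'` — is formally smooth: it is
`𝒪_{Y,g η'}`-isomorphic to the local ring `T_t`. [folklore] -/
private theorem formallySmooth_stalk_of_chart [Algebra.FormallySmooth (Y.presheaf.stalk (g η')) T] :
    letI := (g.stalkMap η').hom.toAlgebra
    Algebra.FormallySmooth (Y.presheaf.stalk (g η')) (Y'.presheaf.stalk η') := by
  letI := (g.stalkMap η').hom.toAlgebra
  -- the local ring `T_t` of `Spec T` at `t`
  let St : Type u := ↥((Spec (.of T)).presheaf.stalk t)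
  letI : Algebra T St := (StructureSheaf.toStalk T t).hom.toAlgebra
  haveI : IsLocalization.AtPrime St t.asIdeal := StructureSheaf.IsLocalization.to_stalk T t
  letI algO : Algebra (Y.presheaf.stalk (g η')) St :=
    ((algebraMap T St).comp (algebraMap (Y.presheaf.stalk (g η')) T)).toAlgebra
  haveI : IsScalarTower (Y.presheaf.stalk (g η')) T St := IsScalarTower.of_algebraMap_eq fun _ => rfl
  haveI : Algebra.FormallySmooth T St := .of_isLocalization t.asIdeal.primeCompl
  haveI : Algebra.FormallySmooth (Y.presheaf.stalk (g η')) St := .comp _ T St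
  -- the comparison `Ψ : 𝒪_{Y',η'} ⟶ T_t`
  have hsp : c t ⤳ η' := specializes_of_eq ht
  let Ψ : Y'.presheaf.stalk η' ⟶ (Spec (.of T)).presheaf.stalk t :=
    Y'.presheaf.stalkSpecializes hsp ≫ c.stalkMap t
  haveI : IsIso (Y'.presheaf.stalkSpecializes hsp) := by
    have : Y'.presheaf.stalkSpecializes hsp = (Y'.presheaf.stalkCongr (Inseparable.of_eq ht)).inv := rfl
    rw [this]; infer_instance
  haveI : IsIso Ψ := IsIso.comp_isIso
  -- compatibility with the structure maps, checked after `Spec` against the mono `Spec 𝒪_{Y,g η'} → Y`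
  have hcomp : g.stalkMap η' ≫ Ψ = CommRingCat.ofHom (algebraMap (Y.presheaf.stalk (g η')) St) := by
    apply Spec.map_injective
    rw [← cancel_mono (Y.fromSpecStalk (g η'))]
    simp only [Ψ, Spec.map_comp, Category.assoc]
    rw [Scheme.SpecMap_stalkMap_fromSpecStalk, Scheme.SpecMap_stalkSpecializes_fromSpecStalk_assoc,
      Scheme.SpecMap_stalkMap_fromSpecStalk_assoc, hc, Spec.fromSpecStalk_eq']
    exact (Spec.map_comp_assoc _ _ _).symm
  -- the `𝒪_{Y,g η'}`-algebra isomorphism `𝒪_{Y',η'} ≃ T_t`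
  let e : Y'.presheaf.stalk η' ≃ₐ[Y.presheaf.stalk (g η')] St :=
    AlgEquiv.ofRingEquiv (f := (asIso Ψ).commRingCatIsoToRingEquiv) (fun x => by
      change (g.stalkMap η' ≫ Ψ) x = _
      rw [hcomp]; rfl)
  exact Algebra.FormallySmooth.of_equiv e.symm

end Chart

/-! ## Local algebra: a flat, formally smooth local homomorphism with equal dimensions -/

section Algebra

variable (O B : Type u) [CommRing O] [IsLocalRing O] [IsNoetherianRing O] [CommRing B] [IsLocalRing B]
  [IsNoetherianRing B] [Algebra O B] [IsLocalHom (algebraMap O B)] [Algebra.FormallySmooth O B]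

/-- **`𝔪_O B = 𝔪_B` when the dimensions agree** (no finiteness hypothesis).  For a flat local homomorphism
`O → B` of Noetherian local rings which is formally smooth, with `dim O = dim B`: by flat going-down
(`Ideal.height_eq_height_add_of_liesOver_of_hasGoingDown`) the fibre ring `B ⧸ 𝔪_O B` — a Noetherian
local ring, formally smooth over the residue field `κ(O)` (base change) — has dimension `0`, hence is a
FIELD by Matsumura §28 Lemma 1 in dimension `0`
(`Literature.RingTheory.Smooth.isField_of_ringKrullDim_eq_zero_of_formallySmooth`), so `𝔪_O B = 𝔪_B`.
(res-type-047's `AQSBaseChange.map_maximalIdeal_eq_of_formallySmooth_of_ringKrullDim_eq` assumed moreover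
`Algebra.EssFiniteType O B` to make the fibre regular.) [cite: Matsumura1987, §28 Lemma 1 (p. 216) and Thm. 15.1 / 23.7] -/
theorem map_maximalIdeal_eq_of_formallySmooth_of_flat_of_ringKrullDim_eq [Module.Flat O B]
    {d : ℕ} (hdO : ringKrullDim O = d) (hdB : ringKrullDim B = d) :
    (maximalIdeal O).map (algebraMap O B) = maximalIdeal B := by
  set I : Ideal B := (maximalIdeal O).map (algebraMap O B) with hI
  have hIle : I ≤ maximalIdeal B := Ideal.map_le_iff_le_comap.mpr fun a ha => map_nonunit _ a ha
  -- `𝔪_B` lies over `𝔪_O`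
  haveI hover : (maximalIdeal B).LiesOver (maximalIdeal O) :=
    ⟨by
      rw [Ideal.under_def]
      refine ((IsLocalRing.maximalIdeal.isMaximal _).eq_of_le ?_ ?_)
      · exact Ideal.IsPrime.ne_top (Ideal.IsPrime.comap _)
      · exact Ideal.map_le_iff_le_comap.mp hIle⟩
  -- heights: `ht 𝔪_B = ht 𝔪_O + ht (𝔪_B mod I)` by flat going-down, and `ht 𝔪_B = d = ht 𝔪_O`
  have hht := Ideal.height_eq_height_add_of_liesOver_of_hasGoingDown (maximalIdeal O) (maximalIdeal B)
  have h1 : (maximalIdeal B).height = d := by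
    have := IsLocalRing.maximalIdeal_height_eq_ringKrullDim (R := B)
    rw [hdB] at this; exact_mod_cast this
  have h2 : (maximalIdeal O).height = d := by
    have := IsLocalRing.maximalIdeal_height_eq_ringKrullDim (R := O)
    rw [hdO] at this; exact_mod_cast this
  rw [h1, h2] at hht
  have h0 : ((maximalIdeal B).map (Ideal.Quotient.mk I)).height = 0 := by
    have h3 : (d : ℕ∞) + ((maximalIdeal B).map (Ideal.Quotient.mk I)).height = (d : ℕ∞) + 0 := by
      rw [add_zero]; exact hht.symm
    exact (add_right_inj_of_ne_top (ENat.coe_ne_top d)).mp h3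
  -- the fibre ring `F = B ⧸ I`: local Noetherian, formally smooth over `κ(O)`, of dimension `0` — a field
  haveI : Nontrivial (B ⧸ I) :=
    Ideal.Quotient.nontrivial_iff.mpr (ne_top_of_le_ne_top (Ideal.IsPrime.ne_top inferInstance) hIle)
  haveI : IsLocalRing (B ⧸ I) := IsLocalRing.of_surjective' (Ideal.Quotient.mk I) Ideal.Quotient.mk_surjective
  have hmk : (maximalIdeal B).map (Ideal.Quotient.mk I) = maximalIdeal (B ⧸ I) :=
    IsLocalRing.map_maximalIdeal_of_surjective (Ideal.Quotient.mk I) Ideal.Quotient.mk_surjective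
  letI : Field (O ⧸ maximalIdeal O) := Ideal.Quotient.field (maximalIdeal O)
  haveI : Algebra.FormallySmooth (O ⧸ maximalIdeal O) (B ⧸ I) :=
    Algebra.FormallySmooth.of_equiv (Algebra.TensorProduct.quotIdealMapEquivQuotTensor B (maximalIdeal O)).symm
  have hdimF : ringKrullDim (B ⧸ I) = 0 := by
    have := IsLocalRing.maximalIdeal_height_eq_ringKrullDim (R := B ⧸ I)
    rw [← hmk, h0] at this
    exact_mod_cast this.symm
  have hF : IsField (B ⧸ I) :=
    Literature.RingTheory.Smooth.isField_of_ringKrullDim_eq_zero_of_formallySmooth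
      (O ⧸ maximalIdeal O) (B ⧸ I) hdimF
  have hFbot : maximalIdeal (B ⧸ I) = ⊥ := (IsLocalRing.isField_iff_maximalIdeal_eq).mp hF
  refine le_antisymm hIle ?_
  rw [← hmk, Ideal.map_eq_bot_iff_le_ker, Ideal.mk_ker] at hFbot
  exact hFbot

omit [IsNoetherianRing O] [IsNoetherianRing B] in
/-- **The residue field extension of a formally smooth local homomorphism with `𝔪_O B = 𝔪_B` is formally
smooth** (`κ(B) = B ⧸ 𝔪_O B` is a base change of `O → B`).  [folklore] -/
private theorem formallySmooth_residueField_of_map_maximalIdeal_eq_maximalIdeal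
    (h : (maximalIdeal O).map (algebraMap O B) = maximalIdeal B) :
    letI := (IsLocalRing.ResidueField.map (algebraMap O B)).toAlgebra
    Algebra.FormallySmooth (ResidueField O) (ResidueField B) := by
  set I : Ideal B := (maximalIdeal O).map (algebraMap O B) with hI
  haveI : Algebra.FormallySmooth (O ⧸ maximalIdeal O) (B ⧸ I) :=
    Algebra.FormallySmooth.of_equiv (Algebra.TensorProduct.quotIdealMapEquivQuotTensor B (maximalIdeal O)).symm
  letI alg : Algebra (O ⧸ maximalIdeal O) (ResidueField B) :=
    (IsLocalRing.ResidueField.map (algebraMap O B)).toAlgebra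
  let e : (B ⧸ I) ≃ₐ[O ⧸ maximalIdeal O] ResidueField B :=
    AlgEquiv.ofRingEquiv (f := Ideal.quotEquivOfEq h) (fun x => by
      obtain ⟨o, rfl⟩ := Ideal.Quotient.mk_surjective x
      rfl)
  have key : @Algebra.FormallySmooth (O ⧸ maximalIdeal O) (ResidueField B) _ _ alg :=
    Algebra.FormallySmooth.of_equiv e
  exact key

end Algebra

/-! ## The square `Y' = Y ×ₖ Spec K → Y` along a formally smooth `K/k` -/

section Square

variable {k : Type u} [Field k] {Y : Scheme.{u}} (f : Y ⟶ Spec (.of k))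
  (K : Type u) [Field K] [Algebra k K] {Y' : Scheme.{u}} {f' : Y' ⟶ Spec (.of K)} {g : Y' ⟶ Y}
  (hsq : IsPullback g f' f (Spec.map (CommRingCat.ofHom (algebraMap k K))))
include hsq

variable [Algebra.FormallySmooth k K]

/-- **`𝒪_{Y',η'}` is formally smooth over `𝒪_{Y,g η'}`** (through `g.stalkMap η'`), for `K/k` formally smooth
(no finiteness hypothesis on `K/k`): the chart `Spec (𝒪_{Y,g η'} ⊗ₖ K) → Y ×ₖ Spec K ≅ Y'` through the
local scheme at `g η'` (`stalkTensorChart`) hits `η'` with isomorphic stalks, and the chart lemma applies.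
(res-type-047's `formallySmooth_and_essFiniteType_stalk_of_isPullback`, formally smooth half.) [folklore] -/
private theorem formallySmooth_stalk_of_isPullback (η' : Y') :
    letI := (g.stalkMap η').hom.toAlgebra
    Algebra.FormallySmooth (Y.presheaf.stalk (g η')) (Y'.presheaf.stalk η') := by
  set e := hsq.isoPullback with he
  -- the chart through the local scheme at `y₀ = g η'`
  let T : Type u := StalkOver f (g η') ⊗[k] K
  letI algOT : Algebra (Y.presheaf.stalk (g η')) T :=
    (inferInstance : Algebra (StalkOver f (g η')) (StalkOver f (g η') ⊗[k] K))
  haveI : Algebra.FormallySmooth (Y.presheaf.stalk (g η')) T :=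
    (inferInstance : Algebra.FormallySmooth (StalkOver f (g η')) (StalkOver f (g η') ⊗[k] K))
  let c : Spec (.of T) ⟶ Y' := stalkTensorChart K f (g η') ≫ e.inv
  -- a point `t` of the chart over `η'`
  have hy : pullback.fst f (specOfAlgebra k K) (e.hom η') ⤳ g η' := by
    rw [← Scheme.Hom.comp_apply, he, hsq.isoPullback_hom_fst]
  obtain ⟨t, hct⟩ := exists_stalkTensorChart_eq (E := K) f (g η') (e.hom η') hy
  have ht : c t = η' := by
    show (stalkTensorChart K f (g η') ≫ e.inv) t = η'
    rw [Scheme.Hom.comp_apply, hct, ← Scheme.Hom.comp_apply, Iso.hom_inv_id]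
    rfl
  haveI i1 : IsIso (e.inv.stalkMap (stalkTensorChart K f (g η') t)) := inferInstance
  haveI i2 : IsIso ((stalkTensorChart K f (g η')).stalkMap t) := isIso_stalkMap_stalkTensorChart K f (g η') t
  haveI : IsIso (c.stalkMap t) := by
    show IsIso ((stalkTensorChart K f (g η') ≫ e.inv).stalkMap t)
    rw [Scheme.Hom.stalkMap_comp]
    exact @IsIso.comp_isIso _ _ _ _ _ _ _ i1 i2
  have hc : c ≫ g = Spec.map (CommRingCat.ofHom (algebraMap (Y.presheaf.stalk (g η')) T)) ≫
      Y.fromSpecStalk (g η') := by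
    have h1 : c ≫ g = stalkTensorChart K f (g η') ≫ pullback.fst f (specOfAlgebra k K) := by
      show (stalkTensorChart K f (g η') ≫ e.inv) ≫ g = _
      rw [Category.assoc, he, hsq.isoPullback_inv_fst]
    have h2 : CommRingCat.ofHom (algebraMap (Y.presheaf.stalk (g η')) T) =
        CommRingCat.ofHom (Algebra.TensorProduct.includeLeftRingHom (R := k) (A := StalkOver f (g η'))
          (B := K)) := by
      congr 1
    rw [h1, h2, stalkTensorChart, specTensorChart_fst, StalkOver.fromSpec, StalkOver.iso, Iso.refl_hom]
    erw [Spec.map_id, Category.id_comp]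
    rfl
  exact formallySmooth_stalk_of_chart g η' T c t ht hc

variable [LocallyOfFiniteType f]

/-- **The local data of the base-change square at a point where the dimension does not go up.**  For
`f : Y → Spec k` locally of finite type, `K/k` a formally smooth field extension (no finiteness hypothesis),
a cartesian square `g : Y' = Y ×ₖ Spec K → Y`, and a point `η' ∈ Y'` with `𝒪_{Y,g η'}` regular and
`dim 𝒪_{Y,g η'} = dim 𝒪_{Y',η'}`, the local homomorphism `φ = g.stalkMap η' : 𝒪_{Y,g η'} → 𝒪_{Y',η'}`
satisfies: (i) `𝔪 𝒪_{Y',η'} = 𝔪'`; (ii) `𝒪_{Y',η'}` is regular (Matsumura 23.7 (ii)); (iii) `φ` is flat;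
(iv) the residue field extension `κ(g η') → κ(η')` is formally smooth; and (v) `f'` is locally of finite
type.  (res-type-047's `AQSBaseChange.separableBaseChange_localData` without `Algebra.EssFiniteType k K`.)
[cite: Matsumura1987, Thm. 23.7 (ii) (p. 182), §28 Lemma 1 (p. 216)] -/
theorem formallySmoothBaseChange_localData (η' : Y')
    (hreg : IsRegularLocalRing (Y.presheaf.stalk (g η')))
    {d : ℕ} (hdim : ringKrullDim (Y.presheaf.stalk (g η')) = d)
    (hdim' : ringKrullDim (Y'.presheaf.stalk η') = d) :
    (maximalIdeal (Y.presheaf.stalk (g η'))).map (g.stalkMap η').hom = maximalIdeal (Y'.presheaf.stalk η') ∧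
      IsRegularLocalRing (Y'.presheaf.stalk η') ∧ (g.stalkMap η').hom.Flat ∧
      (letI := (IsLocalRing.ResidueField.map (g.stalkMap η').hom).toAlgebra
       Algebra.FormallySmooth (ResidueField (Y.presheaf.stalk (g η'))) (ResidueField (Y'.presheaf.stalk η'))) ∧
      LocallyOfFiniteType f' := by
  haveI hlft : LocallyOfFiniteType f' := by
    rw [← hsq.isoPullback_hom_snd]
    infer_instance
  haveI : IsLocallyNoetherian Y' := LocallyOfFiniteType.isLocallyNoetherian f'
  haveI : IsLocallyNoetherian Y := LocallyOfFiniteType.isLocallyNoetherian f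
  -- `g` is flat: a base change of the flat `Spec K → Spec k`
  haveI : Flat g := by
    haveI : Flat (specOfAlgebra k K) := Flat.SpecMap_iff.mpr (RingHom.flat_algebraMap_iff.mpr inferInstance)
    rw [← hsq.isoPullback_hom_fst]
    infer_instance
  letI := (g.stalkMap η').hom.toAlgebra
  haveI : Module.Flat (Y.presheaf.stalk (g η')) (Y'.presheaf.stalk η') := Flat.stalkMap g η'
  haveI : IsLocalHom (algebraMap (Y.presheaf.stalk (g η')) (Y'.presheaf.stalk η')) :=
    inferInstanceAs (IsLocalHom (g.stalkMap η').hom)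
  haveI hfs := formallySmooth_stalk_of_isPullback f K hsq η'
  have h1 := map_maximalIdeal_eq_of_formallySmooth_of_flat_of_ringKrullDim_eq (Y.presheaf.stalk (g η'))
    (Y'.presheaf.stalk η') hdim hdim'
  exact ⟨h1, IsRegularLocalRing.of_flat_of_map_maximalIdeal_eq _ _ h1, Flat.stalkMap g η',
    formallySmooth_residueField_of_map_maximalIdeal_eq_maximalIdeal _ _ h1, hlft⟩

end Square

end Literature.AlgebraicGeometry.Resolution

end
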